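import Mathlib
import Summits.NavierStokesRegularity.NavierStokesRegularity.Theorems.TaoLadderRungTwoBreakOneShiftWindowSensK2Rows
import Summits.NavierStokesRegularity.NavierStokesRegularity.Theorems.TaoLadderRungTwoBreakOneShiftWindowSensGridM
import Summits.NavierStokesRegularity.NavierStokesRegularity.Theorems.TaoLadderRungTwoBreakOneShiftWindowWinInGlue
import HarnessLib

/-!
# One-shift window certificate, kernel side — part LXXII: THE TAIL-LIPSCHITZ HYPOTHESIS (K2) OF THE KRAWCZYK BLOCK AND THE
# WINDOW-BLOCK CLAUSE `hWedge` FROM THE MASKED TWO-RUN SENSITIVITY CHAIN — row-wise twins from the edge bounds and the two row masks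
# (wake factors live on the rows of window shell `0`, top factors on those of shell `W − 1`), part LXXIV's masked chain with zero start
# difference, part LXXIIa's row test, part XII `K2_of_runTailSensitivity`, and part V `krawczyk_wedge` with (K1) = part LVIII
# `K1_of_gridCE` (cell harvest/h2-tao-ladder, seat p2; rung1/RUNG1-P2G16-REPORT.md §83 (K2: hWedge); support for K1(1) =
# `NoSurvivingDSSOne`, stmt-NavierStokesRegularity-20205)

MODEL lattice only (the finite WINDOW system of a Tao-type averaged cascade); nothing here is a statement about the
Navier–Stokes equations; no item is closed; nothing numerical is asserted.

* `OneShiftFrame.shell_cases_row`, `OneShiftFrame.twin_rows_of_edges`;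
* **`OneShiftFrame.K2_of_gridCE`** — (K2) for the preconditioner `linOfMatrix (kd.CmatR …)` from the replay Booleans, the masked
  sensitivity chain and `k2OK`; **`OneShiftFrame.hWedge_of_gridCE`** — the clause `hWedge` of `T4W76R.ClausesFor` & co. for the
  CONSTRUCTED certificate.
-/


noncomputable section

-- the sub-problem namespace repeats the summit name by design (D-0017)
set_option linter.dupNamespace false

namespace Summit.NavierStokesRegularity.NavierStokesRegularity.Theorems

namespace DSSOneShift

open Set Finset Metric Filter Topology TopologicalSpace
open Literature.Analysis.ODE Literature.Analysis.FluidPDE Literature.Analysis.FluidPDE.TaoCascade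
open Summit.NavierStokesRegularity.NavierStokesRegularity.Theorems.TaylorModelCert
open Summit.NavierStokesRegularity.NavierStokesRegularity.Theorems.TaylorModelReadout
open Summit.NavierStokesRegularity.NavierStokesRegularity.Theorems.CertificateGlueOn

variable {m : ℕ}

/-! ### (K2) and the clause `hWedge` from the grid -/

namespace OneShiftFrame

variable (F : OneShiftFrame m)

/-- **Refined shell cases on Tao's shift set**: a wake factor (shell `-1`) occurs only in the rows of window shell `0`, a top
factor (shell `W`) only in the rows of window shell `W − 1`. [cite: Tao2016AveragedNS, §4 after (4.1)] -/
theorem shell_cases_row (j : Fin F.W) {μ : ℤ × ℤ × ℤ} (hμ : μ ∈ shiftSet) {ν : ℤ} (hν : ν = μ.1 ∨ ν = μ.2.1) {k : ℤ}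
    (hk : k = ((j : ℕ) : ℤ) - μ.2.2 + ν) (hkw : ¬ F.InWindow k) :
    (k = -1 ∧ (j : ℕ) = 0) ∨ (k = F.W ∧ (j : ℕ) + 1 = F.W) := by
  have hj : ((j : ℕ) : ℤ) < F.W := by exact_mod_cast j.isLt
  have hj0 : (0 : ℤ) ≤ ((j : ℕ) : ℤ) := by positivity
  simp only [OneShiftFrame.InWindow, not_and_or, not_le, not_lt] at hkw
  rcases (mem_shiftSet_iff μ).1 hμ with h | h | h | h <;> subst h <;> simp only at hν hk <;>
    rcases hν with rfl | rfl <;> omega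

/-- **Row-wise twins from the edge bounds and the two row masks.** Two admissible points whose wake / top tails differ by
`≤ B` / `≤ E` on the flight give, on every row `o`, twin factors at distance `B·[mW o] + E·[mT o]` provided the masks contain
the rows of window shell `0` resp. `W − 1` and the row lists only hold terms of their own output.
[cite: Tao2016AveragedNS, §4 Lemma 4.1 (4.8); cell vocabulary, harvest/h2-tao-ladder rung1/RUNG1-P2G16-REPORT.md §83 (β_b, β_e supported on the edge rows)] -/
theorem twin_rows_of_edges (ε₀ : ℝ) (α : Fin m → Fin m → Fin m → ℤ × ℤ × ℤ → ℝ) {u v : F.Space} (hu : F.Adm u)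
    (hv : F.Adm v) {B E : ℝ} (hB0 : 0 ≤ B) (hE0 : 0 ≤ E)
    (hB : ∀ i, ∀ t ∈ Icc 0 F.τhi, |F.decodeTail u i (-1) t - F.decodeTail v i (-1) t| ≤ B)
    (hE : ∀ i, ∀ t ∈ Icc 0 F.τhi, |F.decodeTail u i F.W t - F.decodeTail v i F.W t| ≤ E)
    {n : ℕ} (e : F.SIdx ≃ Fin n) (mW mT : ℕ → Bool) (hmW : ∀ i (j : Fin F.W), (j : ℕ) = 0 → mW (e (i, j)) = true)
    (hmT : ∀ i (j : Fin F.W), (j : ℕ) + 1 = F.W → mT (e (i, j)) = true)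
    (rows : F.SIdx → List F.TIdx) (hrows : ∀ o, ∀ q ∈ rows o, q.1 = o) (t : ℝ) (o : F.SIdx) :
    ∀ q ∈ rows o,
      Factor.Twin (B * maskR mW (e o) + E * maskR mT (e o)) (F.wterms ε₀ α (F.preclampTail u) t q).fa
        (F.wterms ε₀ α (F.preclampTail v) t q).fa ∧
      Factor.Twin (B * maskR mW (e o) + E * maskR mT (e o)) (F.wterms ε₀ α (F.preclampTail u) t q).fb
        (F.wterms ε₀ α (F.preclampTail v) t q).fb := by
  intro q hq
  have hqo : q.1 = o := hrows o q hq
  have hμ : q.2.2.2.1 ∈ shiftSet := Finset.mem_coe.1 q.2.2.2.2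
  have hmB : 0 ≤ B * maskR mW (e o) := mul_nonneg hB0 (maskR_nonneg _ _)
  have hmE : 0 ≤ E * maskR mT (e o) := mul_nonneg hE0 (maskR_nonneg _ _)
  have key : ∀ (i : Fin m) {ν : ℤ} (hν : ν = q.2.2.2.1.1 ∨ ν = q.2.2.2.1.2.1),
      Factor.Twin (B * maskR mW (e o) + E * maskR mT (e o))
        (F.factorAt (F.preclampTail u) t i (((q.1.2 : ℕ) : ℤ) - q.2.2.2.1.2.2 + ν))
        (F.factorAt (F.preclampTail v) t i (((q.1.2 : ℕ) : ℤ) - q.2.2.2.1.2.2 + ν)) := by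
    intro i ν hν
    set kk : ℤ := ((q.1.2 : ℕ) : ℤ) - q.2.2.2.1.2.2 + ν with hkk
    by_cases hkw : F.InWindow kk
    · simp only [factorAt, dif_pos hkw]
      exact rfl
    · simp only [factorAt, dif_neg hkw]
      show |F.preclampTail u i kk t - F.preclampTail v i kk t| ≤ B * maskR mW (e o) + E * maskR mT (e o)
      rcases F.shell_cases_row q.1.2 hμ hν hkk hkw with ⟨h, hj⟩ | ⟨h, hj⟩
      · rw [h, F.preclampTail_eq_decodeTail hu i F.not_inWindow_edges.1, F.preclampTail_eq_decodeTail hv i F.not_inWindow_edges.1]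
        have hm : maskR mW (e o) = 1 := by
          rw [← hqo]; simp only [maskR, hmW q.1.1 q.1.2 hj, if_true]
        rw [hm, mul_one]
        exact (F.abs_decodeTail_sub_le_all hB i t).trans (le_add_of_nonneg_right hmE)
      · rw [h, F.preclampTail_eq_decodeTail hu i F.not_inWindow_edges.2, F.preclampTail_eq_decodeTail hv i F.not_inWindow_edges.2]
        have hm : maskR mT (e o) = 1 := by
          rw [← hqo]; simp only [maskR, hmT q.1.1 q.1.2 hj, if_true]
        rw [hm, mul_one]
        exact (F.abs_decodeTail_sub_le_all hE i t).trans (le_add_of_nonneg_left hmB)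
  exact ⟨key q.2.1 (Or.inl rfl), key q.2.2.1 (Or.inr rfl)⟩

section Glue

variable {ε₀ : ℝ} {α : Fin m → Fin m → Fin m → ℤ × ℤ × ℤ → ℝ} {R : ℤ → ℝ}
variable {g : GridCD} {kd : KrawD} {e : F.SIdx ≃ Fin g.n}

/-- **(K2) FROM THE CENTRED GRID, THE MASKED SENSITIVITY CHAIN AND THE ROW TEST.** With the instance facts of the row, the
replay Booleans of the wave, the link Boolean `linkK1`, the MASKED sensitivity / link Booleans of part LXXIV (masks containing the
rows of window shells `0` and `W − 1`; row lists of own-output terms) and the row test `k2OK` read at the final step (`A = |Hs_S|`,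
`χB = pB_S + ZB_S`, `χE = pE_S + ZE_S`, `Gs = G.hi`, `Γm = |Gam|`): the scaled preconditioned residual is Lipschitz in the tails at
frozen point with constants `Sb`, `Se` — hypothesis (K2) of part V `krawczyk_wedge`.
[cite: Tao2016AveragedNS, §5.3; KapelaZgliczynski2009, §4 Lemma 8 / Thm. 9; cell vocabulary, harvest/h2-tao-ladder rung1/RUNG1-P2G9-REPORT.md §37 (hWedge), rung1/RUNG1-P2G16-REPORT.md §83] -/
theorem K2_of_gridCE (hε : 0 ≤ ε₀) (hα : IsCancellingCoeff α)
    (hEb : ∀ i, |F.tubeC i (-1)| + F.tubeR (-1) ≤ F.Eb) (hEt : ∀ i, |F.tubeC i F.W| + F.tubeR F.W ≤ F.Et)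
    (M : F.FrameMatch g.toGridD kd e R) (hkn : kd.rs.n = g.n) (hm : 0 < m)
    (Tc : ℕ → F.TIdx → BTerm F.SIdx) (rows : F.SIdx → List F.TIdx) (hrows : ∀ o, ∀ q ∈ rows o, q.1 = o)
    (hRDc : ∀ s ≤ g.S, IsRTEncl (g.es e M.hn s) (Tc s) (Tc s) rows (g.step s).RD)
    (hRD : ∀ u : F.Space, ∀ s ≤ g.S, ∀ r ∈ Ico 0 (g.h s).toReal,
      IsRTEncl (g.es e M.hn s) (Tc s) (F.wterms ε₀ α (F.preclampTail u) (g.t s + r)) rows (g.step s).RD)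
    (hstep : ∀ s ≤ g.S, g.stepOK s = true) (hinit : g.initOK = true) (hprod : ∀ s < g.S, g.prodOKE s = true)
    (hpwf : ∀ s ≤ g.S, g.pwfOK s = true) (hpsub : ∀ s ≤ g.S, g.psubOK s = true)
    (hplink : ∀ s < g.S, g.plinkOK s = true) (hwlink : ∀ s < g.S, g.wlinkOK s = true) (hK1 : g.linkK1 kd = true)
    (hP0 : (fun c : F.SIdx => F.yc c.1 ((c.2 : ℕ) : ℤ)) ∈ boxSet (boxOf e (g.P 0)))
    (sdM : SensD) (mW mT : ℕ → Bool) (hmW : ∀ i (j : Fin F.W), (j : ℕ) = 0 → mW (e (i, j)) = true)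
    (hmT : ∀ i (j : Fin F.W), (j : ℕ) + 1 = F.W → mT (e (i, j)) = true)
    (hsensM : ∀ s ≤ g.S, g.sensStepOKM sdM mW mT s = true) (hlinkM : ∀ s < g.S, g.sensLinkOK sdM s = true)
    (heBox : Dyad.ble kd.rs.energyBox.lo kd.rs.energyBox.hi = true) {Sb Se : Dyad}
    (hk2 : kd.k2OK (fun q => IntervalD.mag (IntervalD.aget (g.step g.S).Hs q)) (fun q => (sdM.pYf g.S q).add (sdM.ZYf g.S q))
      (fun q => (sdM.pTf g.S q).add (sdM.ZTf g.S q)) kd.rs.G.hi (IntervalD.mag kd.rs.Gam) Sb Se = true) :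
    ∀ u v, F.AdmLip R u → F.AdmLip R v → u.1 = v.1 → u.2.1 = v.2.1 → ∀ B E : ℝ,
      (∀ i, ∀ t ∈ Icc 0 F.τhi, |F.decodeTail u i (-1) t - F.decodeTail v i (-1) t| ≤ B) →
      (∀ i, ∀ t ∈ Icc 0 F.τhi, |F.decodeTail u i F.W t - F.decodeTail v i F.W t| ≤ E) →
      (∀ i j, |(F.precondResidual ε₀ α (F.linOfMatrix (kd.CmatR F (e.trans (finCongr hkn.symm)))) u).1 i j -
        (F.precondResidual ε₀ α (F.linOfMatrix (kd.CmatR F (e.trans (finCongr hkn.symm)))) v).1 i j| ≤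
          Sb.toReal * B + Se.toReal * E) ∧
      |(F.precondResidual ε₀ α (F.linOfMatrix (kd.CmatR F (e.trans (finCongr hkn.symm)))) u).2 -
        (F.precondResidual ε₀ α (F.linOfMatrix (kd.CmatR F (e.trans (finCongr hkn.symm)))) v).2| ≤
          Sb.toReal * B + Se.toReal * E := by
  classical
  have hW1 := M.hW1
  have hDW := M.hDW
  have hn := M.hn
  have hW : 0 < F.W := lt_trans zero_lt_one hW1
  set ek : F.SIdx ≃ Fin kd.rs.n := e.trans (finCongr hkn.symm) with hekdef
  have hek : ∀ p : F.SIdx, ((ek p : Fin kd.rs.n) : ℕ) = (e p : ℕ) := fun p => by simp [hekdef]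
  obtain ⟨-, hZb, -, -, he0, hG, hGam, -⟩ := g.of_linkK1 hK1
  have heBox' : kd.rs.energyBox.lo.toReal ≤ kd.rs.energyBox.hi.toReal := (Dyad.ble_iff _ _).1 heBox
  set eLo : ℝ := kd.rs.energyBox.lo.toReal with heLodef
  have hGs : (Real.sqrt eLo)⁻¹ ≤ kd.rs.G.hi.toReal := rsqrt_le_of_gCert hG he0 heBox'
  have hΓ : (1 / (2 * Real.sqrt eLo)) / eLo ≤ (IntervalD.mag kd.rs.Gam).toReal := rsqrtSlope_le_of_gamCert hGam he0 heBox'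
  have hW1' : F.InWindow 1 := ⟨by norm_num, by exact_mod_cast hW1⟩
  have hD' : F.InWindow F.D := ⟨by positivity, by exact_mod_cast hDW⟩
  -- times
  have hτc := F.τc_gt
  have hrτ := F.rτ_pos
  have htS' : g.t g.S ≤ F.τhi := M.htS.trans (by unfold τhi; linarith)
  have hTS' : F.τhi ≤ g.t g.S + (g.h g.S).toReal := M.hTS.le
  -- the run of a point, its reference run, and the final hull
  have hSw : ∀ {w : F.Space}, F.AdmLip R w →
      F.IsRunFrom ε₀ α (F.preclampY w) (F.preclampTail w) (F.windowRunMap ε₀ α (F.preclampY w) (F.preclampTail w)) :=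
    fun hw => F.isRunFrom_windowRunMap hε hW hα hEb hEt hw.1
  have hfw : ∀ {w : F.Space}, F.AdmLip R w → ∀ t ∈ Icc 0 F.τhi,
      HasDerivWithinAt (F.flatRun (F.windowRunMap ε₀ α (F.preclampY w) (F.preclampTail w)))
        (termField (F.wterms ε₀ α (F.preclampTail w) t) (F.flatRun (F.windowRunMap ε₀ α (F.preclampY w) (F.preclampTail w)) t))
        (Icc 0 F.τhi) t := by
    intro w hw t ht
    have h := F.hasDerivWithinAt_flatRun (hSw hw) ht
    rwa [F.wfieldFlat_eq_termField] at h
  have hfc : ∀ {w : F.Space}, F.AdmLip R w → ∀ t ∈ Icc 0 F.τhi,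
      HasDerivWithinAt (F.flatRun (F.windowRunMap ε₀ α (F.preclampY (F.zeroWin w)) (F.preclampTail (F.zeroWin w))))
        (termField (F.wterms ε₀ α (F.preclampTail w) t)
          (F.flatRun (F.windowRunMap ε₀ α (F.preclampY (F.zeroWin w)) (F.preclampTail (F.zeroWin w))) t))
        (Icc 0 F.τhi) t := by
    intro w hw t ht
    have h := F.hasDerivWithinAt_flatRun (F.isRunFrom_windowRunMap hε hW hα hEb hEt (F.adm_zeroWin hw.1)) ht
    rwa [F.preclampTail_zeroWin, F.wfieldFlat_eq_termField] at h
  have hSc0 : ∀ {w : F.Space}, F.AdmLip R w →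
      F.flatRun (F.windowRunMap ε₀ α (F.preclampY (F.zeroWin w)) (F.preclampTail (F.zeroWin w))) 0 =
        fun c : F.SIdx => F.yc c.1 ((c.2 : ℕ) : ℤ) := fun hw =>
    funext fun c => F.flatRun_zeroWin_zero (F.isRunFrom_windowRunMap hε hW hα hEb hEt (F.adm_zeroWin hw.1)) c
  have haw : ∀ {w : F.Space}, F.AdmLip R w →
      F.flatRun (F.windowRunMap ε₀ α (F.preclampY w) (F.preclampTail w)) 0 ∈ boxSet (boxOf e (g.step 0).W) := fun hw =>
    M.hW0 _ fun c => F.abs_flatRun_zero_sub_yc_le (hSw hw) c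
  have hrun : ∀ {w : F.Space}, F.AdmLip R w → ∀ τ ∈ Icc (g.t g.S) F.τhi,
      F.flatRun (F.windowRunMap ε₀ α (F.preclampY w) (F.preclampTail w)) τ ∈ boxSet (boxOf e (g.step g.S).Hs) :=
    fun hw τ hτ => g.traj_mem_Hs_of_gridCE e hn hRDc (hRD _) hstep hinit hprod hpwf hpsub hplink hwlink htS' hP0 (hSc0 hw) (hfc hw)
      (haw hw) rfl (hfw hw) g.S le_rfl τ hτ (hτ.2.trans hTS')
  have hτw : ∀ w : F.Space, F.preclampTau w ∈ Icc (g.t g.S) F.τhi := fun w =>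
    ⟨M.htS.trans (F.preclampTau_mem_box w).1, (F.preclampTau_mem_box w).2⟩
  -- `runAt` read in flat coordinates
  have hrunAt : ∀ (w : F.Space) (i : Fin m) {k : ℤ} (hk : F.InWindow k),
      F.runAt ε₀ α w i k = F.flatRun (F.windowRunMap ε₀ α (F.preclampY w) (F.preclampTail w)) (F.preclampTau w) (i, F.widx hk) := by
    intro w i k hk
    simp only [runAt, CertificateGlueOn.slice, flatRun, OneShiftFrame.widx]
    congr 1
    have := hk.1; omega
  -- hull coordinates as `mem` facts
  have hHs : ∀ {x : F.SIdx → ℝ}, x ∈ boxSet (boxOf e (g.step g.S).Hs) → ∀ c, IntervalD.mem (x c) (IntervalD.aget (g.step g.S).Hs (e c)) := by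
    intro x hx c
    have hchkS : (g.step g.S).check = true := by
      have := hstep g.S le_rfl
      simp only [GridD.stepOK, Bool.and_eq_true, decide_eq_true_eq] at this
      exact this.1
    have hc' : (g.step g.S).toRoughStepD.check = true ∧ (g.step g.S).checkPair = true := by
      simpa [PairStepD.check, Bool.and_eq_true] using hchkS
    have hrc' : (g.step g.S).toRoughStepD.centre.check = true ∧ (g.step g.S).toRoughStepD.checkKZ = true := by
      simpa [RoughStepD.check, Bool.and_eq_true] using hc'.1
    obtain ⟨heta, hKZ⟩ := (g.step g.S).toRoughStepD.of_checkKZ hrc'.2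
    have hcw := (g.step g.S).toRoughStepD.centre.of_checkWith (by rw [← CentreStepD.check_eq]; exact hrc'.1)
    have hwfS : ∀ c < (g.step g.S).n, wfsD (IntervalD.aget (g.step g.S).S c) = true := fun c hc => (hcw.2.2.1 c hc).2.1
    have hZ : ∀ c < (g.step g.S).n, 0 ≤ (RoughStepD.dget (g.step g.S).Zh c).toReal := fun c hc => (hKZ c hc).1
    have hx' : x ∈ boxSet (boxOf (g.es e hn g.S) (g.step g.S).Hs) := by rw [GridD.boxOf_es]; exact hx
    have h := (g.step g.S).toRoughStepD.mem_of_mem_Hs (g.es e hn g.S) hwfS hZ heta hx' c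
    rw [GridD.es_val] at h
    exact h
  -- the data functions
  set Am : ℕ → Dyad := fun q => IntervalD.mag (IntervalD.aget (g.step g.S).Hs q) with hAm
  set χB : ℕ → Dyad := fun q => (sdM.pYf g.S q).add (sdM.ZYf g.S q) with hχB
  set χE : ℕ → Dyad := fun q => (sdM.pTf g.S q).add (sdM.ZTf g.S q) with hχE
  have hAm0 : ∀ q, 0 ≤ (Am q).toReal := fun q => by
    simp only [hAm, IntervalD.mag, Dyad.toReal_max, Dyad.toReal_abs]; exact (abs_nonneg _).trans (le_max_left _ _)
  have hSM := (g.step g.S).of_sensOKM (by simpa [GridD.sensStepOKM] using hsensM g.S le_rfl)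
  have hχB0 : ∀ p : F.SIdx, 0 ≤ (χB (ek p)).toReal := fun p => by
    have hS := hSM (ek p) (by rw [hn, hek]; exact (e p).isLt)
    simp only [hχB, Dyad.toReal_add]
    exact add_nonneg hS.1 hS.2.1
  have hχE0 : ∀ p : F.SIdx, 0 ≤ (χE (ek p)).toReal := fun p => by
    have hS := hSM (ek p) (by rw [hn, hek]; exact (e p).isLt)
    simp only [hχE, Dyad.toReal_add]
    exact add_nonneg hS.2.2.1 hS.2.2.2.1
  -- apply part XII
  refine F.K2_of_runTailSensitivity hm hW1' hD' (F.linOfMatrix (kd.CmatR F ek)) (F.coord_linOfMatrix (kd.CmatR F ek)) R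
    (Sb := Sb.toReal) (Se := Se.toReal)
    (A := fun i k => if h : F.InWindow k then (Am (ek (i, F.widx h))).toReal else 0) (eLo := eLo) he0
    (χb := fun i k => if h : F.InWindow k then (χB (ek (i, F.widx h))).toReal else 0)
    (χe := fun i k => if h : F.InWindow k then (χE (ek (i, F.widx h))).toReal else 0) ?_ ?_ ?_ ?_ ?_
  · -- hA: hull magnitudes
    intro w hw i k hk
    rw [dif_pos hk, hrunAt w i hk, hek]
    exact F.abs_le_mag_of_mem_Hs M hstep (hrun hw _ (hτw w)) (i, F.widx hk)
  · -- he: energy floor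
    intro w hw
    have hx := hrun hw _ (hτw w)
    have hidx1' : ∀ i : Fin m, ResSlopeD.natget kd.rs.idx1 i = (ek (i, ⟨1, hW1⟩) : ℕ) := fun i => by rw [hek]; exact M.hidx1 i
    have hz : ∀ i : Fin m, IntervalD.mem (F.runAt ε₀ α w i 1) (IntervalD.aget kd.rs.Zb (ek (i, ⟨1, hW1⟩))) := by
      intro i
      rw [hrunAt w i hW1', hek]
      have hw1 : F.widx hW1' = ⟨1, hW1⟩ := Fin.ext (by simp [OneShiftFrame.widx])
      rw [hw1]
      exact IntervalD.mem_of_subset (hZb _ (e (i, ⟨1, hW1⟩)).isLt) (hHs hx (i, ⟨1, hW1⟩))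
    exact (ResSlopeD.mem_energyBox_of ek hW1 M.hm hidx1' hz).1
  · -- hsens: the masked chain with zero start difference
    intro w w' hw hw' h1 h2 B E hB hE i k hk
    have ht0' : (0 : ℝ) ∈ Icc 0 F.τhi := ⟨le_rfl, F.τhi_pos.le⟩
    have hB0 : 0 ≤ B := (abs_nonneg _).trans (hB i 0 ht0')
    have hE0 : 0 ≤ E := (abs_nonneg _).trans (hE i 0 ht0')
    have hτeq : F.preclampTau w' = F.preclampTau w := by simp only [preclampTau, h2]
    have hS0 := (g.step 0).of_sensOKM (by simpa [GridD.sensStepOKM] using hsensM 0 (Nat.zero_le _))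
    have h0 : ∀ c : F.SIdx, |F.flatRun (F.windowRunMap ε₀ α (F.preclampY w) (F.preclampTail w)) 0 c -
        F.flatRun (F.windowRunMap ε₀ α (F.preclampY w') (F.preclampTail w')) 0 c| ≤
        (sdM.pYf 0 (e c)).toReal * B + (sdM.pTf 0 (e c)).toReal * E := by
      intro c
      have hy : F.preclampY w = F.preclampY w' := by funext i' k'; simp only [preclampY, h1]
      rw [F.flatRun_zero (hSw hw) c, F.flatRun_zero (hSw hw') c, hy, sub_self, abs_zero]
      have hc := hS0 (e c) (by rw [hn]; exact (e c).isLt)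
      exact add_nonneg (mul_nonneg hc.1 hB0) (mul_nonneg hc.2.2.1 hE0)
    have htw := F.twin_rows_of_edges ε₀ α hw.1 hw'.1 hB0 hE0 hB hE e mW mT hmW hmT rows hrows
    have hres := g.abs_sub_le_of_gridCE_sensM e hn hRDc (hRD w) (hRD w') hstep hinit hprod hpwf hpsub hplink hwlink sdM hsensM
      hlinkM hB0 hE0 htw htS' hP0 (hSc0 hw) (hfc hw) hP0 (hSc0 hw') (hfc hw') (haw hw) rfl (hfw hw) (haw hw') rfl (hfw hw') h0
      g.S le_rfl (F.preclampTau w) (hτw w) ((hτw w).2.trans hTS') (i, F.widx hk)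
    rw [hrunAt w i hk, hrunAt w' i hk, hτeq, dif_pos hk, dif_pos hk, hek]
    simp only [hχB, hχE, Dyad.toReal_add]
    exact hres
  · exact (kd.k2_rows_of_k2OK ek M hek Am χB χE (fun p => hAm0 _) hχB0 hχE0 he0 hGs hΓ hk2).1
  · exact (kd.k2_rows_of_k2OK ek M hek Am χB χE (fun p => hAm0 _) hχB0 hχE0 he0 hGs hΓ hk2).2

/-- **THE WINDOW-BLOCK CLAUSE `hWedge` FROM THE CENTRED GRID** (part V `krawczyk_wedge` with (K1) = part LVIII `K1_of_gridCE`
and (K2) = `K2_of_gridCE`): for the CONSTRUCTED window certificate with the preconditioner `linOfMatrix (kd.CmatR …)`, every two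
`AdmLip` points satisfy `dist(raw window outputs) ≤ Z · dist(u,v) + S_b · B + S_e · E` whenever `ZD ≤ Z`, `Sb ≤ S_b`, `Se ≤ S_e`
— the clause `hWedge` of `T4W76R.ClausesFor` & co. [cite: Tao2016AveragedNS, §5.3; Neumaier1991, §5.1 (Krawczyk operator); cell vocabulary, harvest/h2-tao-ladder rung1/RUNG1-P2G9-REPORT.md §37 (hWedge), rung1/RUNG1-P2G16-REPORT.md §83] -/
theorem hWedge_of_gridCE (hε : 0 ≤ ε₀) (hα : IsCancellingCoeff α)
    (hEb : ∀ i, |F.tubeC i (-1)| + F.tubeR (-1) ≤ F.Eb) (hEt : ∀ i, |F.tubeC i F.W| + F.tubeR F.W ≤ F.Et)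
    (M : F.FrameMatch g.toGridD kd e R) (hkn : kd.rs.n = g.n) (hm : 0 < m)
    (hC : ∀ r, F.linOfMatrix (kd.CmatR F (e.trans (finCongr hkn.symm))) r = 0 → r = 0)
    (Tc : ℕ → F.TIdx → BTerm F.SIdx) (rows : F.SIdx → List F.TIdx) (hrows : ∀ o, ∀ q ∈ rows o, q.1 = o)
    (hRDc : ∀ s ≤ g.S, IsRTEncl (g.es e M.hn s) (Tc s) (Tc s) rows (g.step s).RD)
    (hRD : ∀ u : F.Space, ∀ s ≤ g.S, ∀ r ∈ Ico 0 (g.h s).toReal,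
      IsRTEncl (g.es e M.hn s) (Tc s) (F.wterms ε₀ α (F.preclampTail u) (g.t s + r)) rows (g.step s).RD)
    (hstep : ∀ s ≤ g.S, g.stepOK s = true) (hinit : g.initOK = true) (hprod : ∀ s < g.S, g.prodOKE s = true)
    (hprodS : g.prodOK g.S = true)
    (hpwf : ∀ s ≤ g.S, g.pwfOK s = true) (hpsub : ∀ s ≤ g.S, g.psubOK s = true)
    (hplink : ∀ s < g.S, g.plinkOK s = true) (hwlink : ∀ s < g.S, g.wlinkOK s = true) (hK1 : g.linkK1 kd = true)
    (hP0 : (fun c : F.SIdx => F.yc c.1 ((c.2 : ℕ) : ℤ)) ∈ boxSet (boxOf e (g.P 0)))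
    (sdM : SensD) (mW mT : ℕ → Bool) (hmW : ∀ i (j : Fin F.W), (j : ℕ) = 0 → mW (e (i, j)) = true)
    (hmT : ∀ i (j : Fin F.W), (j : ℕ) + 1 = F.W → mT (e (i, j)) = true)
    (hsensM : ∀ s ≤ g.S, g.sensStepOKM sdM mW mT s = true) (hlinkM : ∀ s < g.S, g.sensLinkOK sdM s = true)
    (heBox : Dyad.ble kd.rs.energyBox.lo kd.rs.energyBox.hi = true) {Sb Se : Dyad}
    (hk2 : kd.k2OK (fun q => IntervalD.mag (IntervalD.aget (g.step g.S).Hs q)) (fun q => (sdM.pYf g.S q).add (sdM.ZYf g.S q))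
      (fun q => (sdM.pTf g.S q).add (sdM.ZTf g.S q)) kd.rs.G.hi (IntervalD.mag kd.rs.Gam) Sb Se = true)
    {Z Sb' Se' : ℝ} (hZD : kd.ZD.toReal ≤ Z) (hSb' : Sb.toReal ≤ Sb') (hSe' : Se.toReal ≤ Se') :
    ∀ u v, F.AdmLip R u → F.AdmLip R v → ∀ B E : ℝ,
      (∀ i, ∀ t ∈ Icc 0 F.τhi, |F.decodeTail u i (-1) t - F.decodeTail v i (-1) t| ≤ B) →
      (∀ i, ∀ t ∈ Icc 0 F.τhi, |F.decodeTail u i F.W t - F.decodeTail v i F.W t| ≤ E) →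
      dist (F.rawWindow (F.windowCertOfMatrix hε (lt_trans zero_lt_one M.hW1) hα hEb hEt
          (F.linOfMatrix (kd.CmatR F (e.trans (finCongr hkn.symm)))) hC) u)
        (F.rawWindow (F.windowCertOfMatrix hε (lt_trans zero_lt_one M.hW1) hα hEb hEt
          (F.linOfMatrix (kd.CmatR F (e.trans (finCongr hkn.symm)))) hC) v) ≤
      Z * dist u v + Sb' * B + Se' * E := by
  classical
  intro u v hu hv B E hB hE
  have hK1' := F.K1_of_gridCE hε hα hEb hEt M hkn Tc rows (fun u t => F.wterms ε₀ α (F.preclampTail u) t)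
    (fun u _ t x => (congrFun (F.wfieldFlat_eq_termField ε₀ α (F.preclampTail u) t) x).symm) hRDc (fun u _ => hRD u)
    hstep hinit hprod hprodS hpwf hpsub hplink hwlink hK1 hP0
  have hK2' := F.K2_of_gridCE hε hα hEb hEt M hkn hm Tc rows hrows hRDc hRD hstep hinit hprod hpwf hpsub hplink hwlink hK1 hP0 sdM mW mT
    hmW hmT hsensM hlinkM heBox hk2
  obtain ⟨-, -, -, -, -, -, -, hKc⟩ := g.of_linkK1 hK1
  have hZ0 : 0 ≤ kd.ZD.toReal := by
    have hc := hKc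
    unfold KrawD.check at hc
    simp only [Bool.and_eq_true, List.all_eq_true, List.mem_range] at hc
    simpa using (Dyad.ble_iff _ _).1 hc.1
  have h := F.krawczyk_wedge hε (lt_trans zero_lt_one M.hW1) hα hEb hEt
    (F.linOfMatrix (kd.CmatR F (e.trans (finCongr hkn.symm)))) hC R hZ0 hK1' hK2' u v hu hv B E hB hE
  have ht0' : (0 : ℝ) ∈ Icc 0 F.τhi := ⟨le_rfl, F.τhi_pos.le⟩
  have hB0 : 0 ≤ B := (abs_nonneg _).trans (hB ⟨0, hm⟩ 0 ht0')
  have hE0 : 0 ≤ E := (abs_nonneg _).trans (hE ⟨0, hm⟩ 0 ht0')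
  have hd := dist_nonneg (x := u) (y := v)
  refine h.trans ?_
  gcongr

end Glue

end OneShiftFrame

end DSSOneShift

end Summit.NavierStokesRegularity.NavierStokesRegularity.Theorems
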